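import Summits.ResolutionOfSingularities.ResolutionOfSingularities.Theorems.PurelyInseparableDim4RidgeBudget
import Summits.ResolutionOfSingularities.ResolutionOfSingularities.Theorems.PurelyInseparableDim4IsolatedCleaning
import Mathlib.LinearAlgebra.Basis.VectorSpace
import Mathlib.LinearAlgebra.Pi
import Mathlib.Algebra.MvPolynomial.PDeriv
import HarnessLib

/-!
# The NARROW LINE of the ridge trichotomy — L0/L1 «APOLARITY: a narrow floor state is curvilinear
along its ridge» (cell `res-dim4-pi`)

[OURS · counted 0 · elementary linear algebra over the TREE's vocabulary (`hasseDeriv`, `singLocusIdeal`,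
`originIdeal`, `PointBlowup.polarMap/additiveSubspace`); nothing here is a statement of any manuscript and
nothing here proves resolution of singularities in dimension ≥ 4 / characteristic `p`.]

CARD I-3-10 (seat idea-3, memo `iso6/N1-PROOF-v2.md` §L0/§L1; critics crit-4 V-A4-11, crit-1 V-A-26
«L1 = apolarity», crit-2 V-B-34) reduces (N1) `RidgeBudget.NarrowDrop p p` to L1/L2/L3; this file is
**L0 + L1a + L1♭**.  Notation: `R = K[x₁..x₄]`, `𝔪 = originIdeal K`, `J = J_q⁺(F) = singLocusIdeal q F`,
`Φ = in F`, `A(Φ) = additiveSubspace Φ = ker(polar map)`.  Everything holds for a general order `q ≥ 2`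
over an ARBITRARY field (the tree realises the additive subspace as the polar kernel).
* §1 **L0**: `coeff_polarMap` (`coeff_β (D_vΦ) = Σᵢ vᵢ (βᵢ+1) coeff_{β+eᵢ}Φ`), `coeff_single_hasseDeriv`
  (the linear part of `D^{(β)}F`, `|β| = q−1`, has the same coefficient row `c_β`), hence
  `mem_additiveSubspace_iff_forall`: `v ∈ A(in F) ⟺ c_β · v = 0 ∀ |β| = q−1`.
* §2 `linearPart_hasseDeriv_mem_sup`: `Σᵢ c_β(i) xᵢ ∈ J ⊔ 𝔪²` (`ord₀ F = q`).
* §3 **L1♭**: `sum_coeff_single_mul_eq_zero` (linear parts of `J ⊔ 𝔪²` kill the ridge); `X_not_mem_sup`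
  (`x_j ∉ J ⊔ 𝔪²` if a ridge vector has `w_j ≠ 0`); `not_originIdeal_le_sup` (`𝔪 ≰ J ⊔ 𝔪²` if `A ≠ 0`).
* §4 **L1a**: `originIdeal_le_of_forall_additiveSubspace` (dual-space form), **`originIdeal_le_span_X_sup`**
  (`ē = 1`, `w ∈ A(in F)`, `w_j ≠ 0 ⇒ 𝔪 ≤ (x_j) ⊔ J ⊔ 𝔪²`), the `ē = 0` twin.
* Continued in `PurelyInseparableDim4NarrowCurvilinear.lean` (L1b `x_j^{μ⁺} ∈ J ⊔ 𝔪ᴹ`; idea-3's literal stub).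

bears_on: LADDER-RESOLUTION:D157-DOOR2 (res-dim4-pi · F4-I(p,p) narrow branch · L0/L1).  Seat res-dim4-p-1 g2
(desk WORD #43: L0/L1/assembly here; L2 = p-5 g2 p661331; L3 = p-7 g2 p661385; colength calculus = p-3 g2).
Supports stmt-ResolutionOfSingularities-16155 (helper).
-/

set_option linter.dupNamespace false

noncomputable section

namespace Summit.ResolutionOfSingularities.ResolutionOfSingularities.Theorems.PIDim4

namespace NarrowApolarity

open MvPolynomial Finset
open Literature.AlgebraicGeometry.Resolution
open Literature.AlgebraicGeometry.Resolution.Hauser2010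
open Literature.AlgebraicGeometry.Resolution.HauserPerlega2019
open PointBlowup (additiveSubspace polarMap)

variable {K : Type} [Field K]

/-! ## 1. L0: the degree-`(q−1)` Hasse layer is the polar map, coefficientwise -/

/-- `D_vΦ = Σᵢ vᵢ ∂ᵢΦ`. [folklore] -/
theorem polarMap_apply (Φ : MvPolynomial (Fin 4) K) (v : Fin 4 → K) :
    polarMap Φ v = ∑ i, v i • pderiv i Φ :=
  Fintype.linearCombination_apply K _ v

/-- **L0, coefficient form of the polar**: `coeff_β (D_vΦ) = Σᵢ vᵢ · coeff_{β+eᵢ}Φ · (βᵢ + 1)`.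
[folklore] -/
theorem coeff_polarMap (Φ : MvPolynomial (Fin 4) K) (v : Fin 4 → K) (β : Fin 4 →₀ ℕ) :
    coeff β (polarMap Φ v) = ∑ i, v i * (coeff (β + Finsupp.single i 1) Φ * (β i + 1)) := by
  rw [polarMap_apply, coeff_sum]
  refine Finset.sum_congr rfl fun i _ => ?_
  rw [coeff_smul, coeff_pderiv, smul_eq_mul]

/-- **L0, the linear part of a Hasse derivative**: `coeff_{eᵢ} (D^{(β)}F) = coeff_{β+eᵢ}F · (βᵢ + 1)`
(`∏ₖ C((β+eᵢ)ₖ, βₖ) = βᵢ + 1`). [folklore] -/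
theorem coeff_single_hasseDeriv (β : Fin 4 →₀ ℕ) (F : MvPolynomial (Fin 4) K) (i : Fin 4) :
    coeff (Finsupp.single i 1) (hasseDeriv β F) = coeff (β + Finsupp.single i 1) F * (β i + 1) := by
  rw [IsolatedBand.coeff_hasseDeriv, add_comm (Finsupp.single i 1) β, mul_comm]
  congr 1
  rw [Finset.prod_eq_single i]
  · rw [Finsupp.single_eq_same, add_comm, Nat.choose_succ_self_right]
    push_cast
    ring
  · intro k _ hki
    rw [Finsupp.single_apply, if_neg (Ne.symm hki), zero_add, Nat.choose_self, Nat.cast_one]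
  · intro h
    exact absurd (Finset.mem_univ i) h

/-- At a point of order exactly `q`, the coefficients of `F` in degree `q` are those of `in F`.
[folklore] -/
theorem coeff_initialForm_of_degree_eq {q : ℕ} {F : MvPolynomial (Fin 4) K} (hord : ordZero F = q)
    {d : Fin 4 →₀ ℕ} (hd : d.degree = q) : coeff d (initialForm F) = coeff d F := by
  rw [Directrix.initialForm_eq_homogeneousComponent hord, coeff_homogeneousComponent, if_pos hd]

/-- Outside degree `q` the initial form has no coefficients. [folklore] -/
theorem coeff_initialForm_of_degree_ne {q : ℕ} {F : MvPolynomial (Fin 4) K} (hord : ordZero F = q)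
    {d : Fin 4 →₀ ℕ} (hd : d.degree ≠ q) : coeff d (initialForm F) = 0 := by
  rw [Directrix.initialForm_eq_homogeneousComponent hord, coeff_homogeneousComponent, if_neg hd]

/-- the degree of `β + eᵢ` is `|β| + 1`. [folklore] -/
theorem degree_add_single (β : Fin 4 →₀ ℕ) (i : Fin 4) :
    (β + Finsupp.single i 1).degree = β.degree + 1 := by
  rw [map_add, Finsupp.degree_single]

/-- **L0 ⟹ the ridge in coefficients**: at a point of order exactly `q`,
`v ∈ A(in F)` iff `Σᵢ vᵢ · coeff_{β+eᵢ}F · (βᵢ+1) = 0` for every `β` with `|β| + 1 = q` — the common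
kernel of the linear parts of the Hasse derivatives `D^{(β)}F`, `|β| = q − 1`
(Euler descent is built into the tree's `additiveSubspace = ker (polar map)`). [OURS · L0 of CARD I-3-10]
[cite: BerthomieuHivertMourtada2010, (2.1) and Cor. 2.3] -/
theorem mem_additiveSubspace_iff_forall {q : ℕ} {F : MvPolynomial (Fin 4) K} (hord : ordZero F = q)
    (v : Fin 4 → K) :
    v ∈ additiveSubspace (initialForm F) ↔
      ∀ β : Fin 4 →₀ ℕ, β.degree + 1 = q →
        ∑ i, v i * (coeff (β + Finsupp.single i 1) F * (β i + 1)) = 0 := by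
  rw [PointBlowup.additiveSubspace, LinearMap.mem_ker]
  constructor
  · intro h β hβ
    have := congrArg (coeff β) h
    rw [coeff_polarMap, coeff_zero] at this
    rw [← this]
    refine Finset.sum_congr rfl fun i _ => ?_
    rw [coeff_initialForm_of_degree_eq hord (by rw [degree_add_single, hβ])]
  · intro h
    ext β
    rw [coeff_polarMap, coeff_zero]
    by_cases hβ : β.degree + 1 = q
    · rw [← h β hβ]
      refine Finset.sum_congr rfl fun i _ => ?_
      rw [coeff_initialForm_of_degree_eq hord (by rw [degree_add_single, hβ])]
    · refine Finset.sum_eq_zero fun i _ => ?_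
      rw [coeff_initialForm_of_degree_ne hord (by rw [degree_add_single]; exact hβ), zero_mul,
        mul_zero]

/-! ## 2. The linear parts of the top Hasse derivatives lie in `J ⊔ 𝔪²` -/

/-- coefficients below the order vanish (numeric form). [folklore] -/
theorem coeff_eq_zero_of_degree_lt {q : ℕ} {F : MvPolynomial (Fin 4) K} (hord : ordZero F = q)
    {d : Fin 4 →₀ ℕ} (hd : d.degree < q) : coeff d F = 0 :=
  ((ordZero_eq_nat_iff F q).mp hord).2 d hd

/-- `D^{(β)}F` minus its linear part lies in `𝔪²` when `|β| + 1 = ord₀ F` (no constant term, and all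
other monomials of `D^{(β)}F` have degree `≥ 2`). [folklore] -/
theorem hasseDeriv_sub_linearPart_mem {q : ℕ} {F : MvPolynomial (Fin 4) K} (hord : ordZero F = q)
    {β : Fin 4 →₀ ℕ} (hβ : β.degree + 1 = q) :
    hasseDeriv β F - ∑ i, (coeff (β + Finsupp.single i 1) F * (β i + 1)) • (X i : MvPolynomial (Fin 4) K) ∈
      originIdeal K ^ 2 := by
  rw [IsolationCert.mem_originIdeal_pow_iff]
  intro d hd
  rw [coeff_sub, coeff_sum]
  simp only [coeff_smul, coeff_X, smul_eq_mul, mul_ite, mul_one, mul_zero]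
  rcases Nat.lt_or_ge d.degree 1 with h0 | h1
  · -- `d = 0`
    have hd0 : d = 0 := (Finsupp.degree_eq_zero_iff d).mp (by omega)
    subst hd0
    rw [IsolatedBand.coeff_hasseDeriv, zero_add, coeff_eq_zero_of_degree_lt hord (by omega), mul_zero,
      zero_sub, neg_eq_zero]
    refine Finset.sum_eq_zero fun i _ => ?_
    rw [if_neg (Finsupp.single_ne_zero.mpr one_ne_zero)]
  · -- `d = eᵢ`
    obtain ⟨i, rfl⟩ := IsolationCert.exists_eq_single_of_degree_eq_one (γ := d) (by omega)
    rw [coeff_single_hasseDeriv, Finset.sum_eq_single i]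
    · rw [if_pos rfl, sub_self]
    · intro k _ hki
      rw [if_neg (fun h => hki (Finsupp.single_left_injective one_ne_zero h))]
    · intro h
      exact absurd (Finset.mem_univ i) h

/-- **The linear part of `D^{(β)}F`, `|β| = q − 1`, lies in `J_q⁺(F) ⊔ 𝔪²`** (`q ≥ 2`, `ord₀ F = q`).
[OURS · L0′ of CARD I-3-10] [folklore] -/
theorem linearPart_hasseDeriv_mem_sup {q : ℕ} (hq : 2 ≤ q) {F : MvPolynomial (Fin 4) K}
    (hord : ordZero F = q) {β : Fin 4 →₀ ℕ} (hβ : β.degree + 1 = q) :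
    (∑ i, (coeff (β + Finsupp.single i 1) F * (β i + 1)) • (X i : MvPolynomial (Fin 4) K)) ∈
      singLocusIdeal q F ⊔ originIdeal K ^ 2 := by
  have hD : hasseDeriv β F ∈ singLocusIdeal q F :=
    Ideal.subset_span ⟨β, by omega, by omega, rfl⟩
  rw [← sub_sub_cancel (hasseDeriv β F)
    (∑ i, (coeff (β + Finsupp.single i 1) F * (β i + 1)) • (X i : MvPolynomial (Fin 4) K))]
  exact Ideal.sub_mem _ (Ideal.mem_sup_left hD)
    (Ideal.mem_sup_right (hasseDeriv_sub_linearPart_mem hord hβ))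

/-! ## 3. L1♭: linear parts of `J ⊔ 𝔪²` kill the ridge -/

/-- `𝔪 = ker (constant coefficient)`. [folklore] -/
theorem mem_originIdeal_iff (G : MvPolynomial (Fin 4) K) : G ∈ originIdeal K ↔ constantCoeff G = 0 := by
  unfold originIdeal
  rw [MvPolynomial.eval_zero, RingHom.mem_ker]

/-- Linear coefficients of a product with a factor without constant term:
`coeff_{eᵢ}(r·x) = r(0) · coeff_{eᵢ} x` when `x(0) = 0`. [folklore] -/
theorem coeff_single_mul_of_constantCoeff_eq_zero (r x : MvPolynomial (Fin 4) K)
    (hx : constantCoeff x = 0) (i : Fin 4) :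
    coeff (Finsupp.single i 1) (r * x) = constantCoeff r * coeff (Finsupp.single i 1) x := by
  -- split `r = C r(0) + r'`, `r' ∈ 𝔪`; then `r' * x ∈ 𝔪²` has no linear coefficients
  have hr' : r - C (constantCoeff r) ∈ originIdeal K := by
    rw [mem_originIdeal_iff, map_sub, constantCoeff_C, sub_self]
  have hx' : x ∈ originIdeal K := (mem_originIdeal_iff x).mpr hx
  have hprod : (r - C (constantCoeff r)) * x ∈ originIdeal K ^ 2 := by
    rw [pow_two]
    exact Ideal.mul_mem_mul hr' hx'
  have hcoeff : coeff (Finsupp.single i 1) ((r - C (constantCoeff r)) * x) = 0 :=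
    (IsolationCert.mem_originIdeal_pow_iff 2 _).mp hprod _ (by rw [Finsupp.degree_single]; omega)
  rw [sub_mul, coeff_sub, coeff_C_mul, sub_eq_zero] at hcoeff
  exact hcoeff

/-- **L1♭.**  At a point of order exactly `q`, for every ridge vector `w ∈ A(in F)` and every
`G ∈ J_q⁺(F) ⊔ 𝔪²`, the linear part of `G` kills `w`: `Σᵢ coeff_{eᵢ}(G) wᵢ = 0`.  (Generators: the
linear part of `D^{(α)}F` is `0` for `|α| < q − 1` and is the polar row for `|α| = q − 1`; the property
is stable under `+` and under multiplication by `r`, which rescales linear parts by `r(0)` on `𝔪`.)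
[OURS · L1♭ of CARD I-3-10] [folklore] -/
theorem sum_coeff_single_mul_eq_zero {q : ℕ} {F : MvPolynomial (Fin 4) K} (hord : ordZero F = q)
    {w : Fin 4 → K} (hw : w ∈ additiveSubspace (initialForm F)) {G : MvPolynomial (Fin 4) K}
    (hG : G ∈ singLocusIdeal q F ⊔ originIdeal K ^ 2) :
    ∑ i, coeff (Finsupp.single i 1) G * w i = 0 := by
  -- the property, together with `G(0) = 0`, on the ideal `J`
  have hJ : ∀ G ∈ singLocusIdeal q F,
      constantCoeff G = 0 ∧ ∑ i, coeff (Finsupp.single i 1) G * w i = 0 := by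
    intro G hG
    refine Submodule.span_induction (p := fun G _ =>
      constantCoeff G = 0 ∧ ∑ i, coeff (Finsupp.single i 1) G * w i = 0) ?_ ?_ ?_ ?_ hG
    · rintro _ ⟨α, hα0, hαq, rfl⟩
      refine ⟨?_, ?_⟩
      · show coeff 0 (hasseDeriv α F) = 0
        rw [IsolatedBand.coeff_hasseDeriv, zero_add, coeff_eq_zero_of_degree_lt hord hαq, mul_zero]
      · simp only [coeff_single_hasseDeriv]
        by_cases hα : α.degree + 1 = q
        · have := (mem_additiveSubspace_iff_forall hord w).mp hw α hα
          rw [← this]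
          exact Finset.sum_congr rfl fun i _ => by ring
        · refine Finset.sum_eq_zero fun i _ => ?_
          rw [coeff_eq_zero_of_degree_lt hord (by rw [degree_add_single]; omega), zero_mul, zero_mul]
    · exact ⟨constantCoeff.map_zero, by simp⟩
    · rintro x y - - ⟨hx0, hx⟩ ⟨hy0, hy⟩
      refine ⟨by rw [map_add, hx0, hy0, add_zero], ?_⟩
      simp only [coeff_add, add_mul, Finset.sum_add_distrib, hx, hy, add_zero]
    · rintro r x - ⟨hx0, hx⟩
      refine ⟨by rw [smul_eq_mul, map_mul, hx0, mul_zero], ?_⟩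
      simp only [smul_eq_mul, coeff_single_mul_of_constantCoeff_eq_zero r x hx0, mul_assoc,
        ← Finset.mul_sum, hx, mul_zero]
  -- on `𝔪²` the linear coefficients vanish
  have hM : ∀ G ∈ originIdeal K ^ 2, ∑ i, coeff (Finsupp.single i 1) G * w i = 0 := by
    intro G hG
    refine Finset.sum_eq_zero fun i _ => ?_
    rw [(IsolationCert.mem_originIdeal_pow_iff 2 G).mp hG _ (by rw [Finsupp.degree_single]; omega),
      zero_mul]
  obtain ⟨a, ha, b, hb, rfl⟩ := Submodule.mem_sup.mp hG
  simp only [coeff_add, add_mul, Finset.sum_add_distrib, (hJ a ha).2, hM b hb, add_zero]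

/-- **`x_j ∉ J_q⁺(F) ⊔ 𝔪²` when the ridge has a vector with `w_j ≠ 0`.** [OURS · L1♭] [folklore] -/
theorem X_not_mem_sup {q : ℕ} {F : MvPolynomial (Fin 4) K} (hord : ordZero F = q) {w : Fin 4 → K}
    (hw : w ∈ additiveSubspace (initialForm F)) {j : Fin 4} (hwj : w j ≠ 0) :
    (X j : MvPolynomial (Fin 4) K) ∉ singLocusIdeal q F ⊔ originIdeal K ^ 2 := by
  intro h
  apply hwj
  have := sum_coeff_single_mul_eq_zero hord hw h
  rw [Finset.sum_eq_single j] at this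
  · simpa [coeff_X] using this
  · intro k _ hkj
    rw [coeff_X, if_neg (fun h => hkj (Finsupp.single_left_injective one_ne_zero h).symm), zero_mul]
  · intro h
    exact absurd (Finset.mem_univ j) h

/-- **`𝔪 ≰ J_q⁺(F) ⊔ 𝔪²` when `A(in F) ≠ 0`** (`ē ≥ 1`): the embedding dimension of `R/J` is
positive.  With a certificate this is «`μ⁺(F) ≥ 2`» (p-3 g2's `…JetColength`). [OURS · L1♭] [folklore] -/
theorem not_originIdeal_le_sup {q : ℕ} {F : MvPolynomial (Fin 4) K} (hord : ordZero F = q)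
    (hA : additiveSubspace (initialForm F) ≠ ⊥) :
    ¬ originIdeal K ≤ singLocusIdeal q F ⊔ originIdeal K ^ 2 := by
  intro hle
  apply hA
  rw [Submodule.eq_bot_iff]
  intro w hw
  funext j
  by_contra hwj
  exact X_not_mem_sup hord hw hwj (hle ((mem_originIdeal_iff _).mpr (constantCoeff_X K j)))

/-! ## 4. L1a: apolarity ⇒ curvilinear -/

/-- The substitution of linear forms `u ↦ Σᵢ uᵢ xᵢ`. [folklore] -/
theorem linearCombination_X_single (i : Fin 4) :
    Fintype.linearCombination K (fun k => (X k : MvPolynomial (Fin 4) K))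
      (fun k => if i = k then (1 : K) else 0) = X i := by
  rw [Fintype.linearCombination_apply]
  simp [Finset.sum_ite_eq]

/-- **Dual-space form of apolarity.**  Let `ord₀ F = q ≥ 2` and let `I` be an ideal containing
`J_q⁺(F) ⊔ 𝔪²`.  If every ridge vector `u ∈ A(in F)` vanishing on the coordinates `{i : xᵢ ∈ I}` is
`0`, then `𝔪 ≤ I`.  (Otherwise a non-zero functional on `K⁴` kills the pre-image of `I` under
`u ↦ Σ uᵢxᵢ`; its Riesz vector `u` kills every row `c_β` of §1 — these rows map to the linear parts of
the `D^{(β)}F ∈ J ⊔ 𝔪² ≤ I` — so `u ∈ A(in F)` by L0, and `u_i = 0` whenever `xᵢ ∈ I`; hence `u = 0`,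
i.e. the functional is `0`.) [OURS · L1a of CARD I-3-10] [folklore] -/
theorem originIdeal_le_of_forall_additiveSubspace {q : ℕ} (hq : 2 ≤ q) {F : MvPolynomial (Fin 4) K}
    (hord : ordZero F = q) {I : Ideal (MvPolynomial (Fin 4) K)}
    (hI : singLocusIdeal q F ⊔ originIdeal K ^ 2 ≤ I)
    (h : ∀ u ∈ additiveSubspace (initialForm F),
      (∀ i : Fin 4, (X i : MvPolynomial (Fin 4) K) ∈ I → u i = 0) → u = 0) :
    originIdeal K ≤ I := by
  classical
  let lin : (Fin 4 → K) →ₗ[K] MvPolynomial (Fin 4) K :=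
    Fintype.linearCombination K (fun k => (X k : MvPolynomial (Fin 4) K))
  let T : Submodule K (Fin 4 → K) := (Submodule.restrictScalars K I).comap lin
  -- `T = ⊤`
  have hT : T = ⊤ := by
    by_contra hne
    obtain ⟨f, hf0, hTf⟩ := Submodule.exists_le_ker_of_lt_top T (lt_top_iff_ne_top.mpr hne)
    set u : Fin 4 → K := fun i => f (fun k => if i = k then (1 : K) else 0) with hu
    have hfx : ∀ x : Fin 4 → K, f x = ∑ i, x i * u i := fun x => by
      rw [LinearMap.pi_apply_eq_sum_univ f x]
      rfl
    -- `u` kills every row `c_β`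
    have huA : u ∈ additiveSubspace (initialForm F) := by
      rw [mem_additiveSubspace_iff_forall hord]
      intro β hβ
      have hmem : (fun i => coeff (β + Finsupp.single i 1) F * (β i + 1)) ∈ T := by
        show lin _ ∈ Submodule.restrictScalars K I
        rw [Submodule.restrictScalars_mem]
        have := hI (linearPart_hasseDeriv_mem_sup hq hord hβ)
        convert this using 1
        exact Fintype.linearCombination_apply K _ _
      have := hTf hmem
      rw [LinearMap.mem_ker, hfx] at this
      rw [← this]
      exact Finset.sum_congr rfl fun i _ => by ring
    -- `u_i = 0` whenever `x_i ∈ I`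
    have hui : ∀ i : Fin 4, (X i : MvPolynomial (Fin 4) K) ∈ I → u i = 0 := by
      intro i hi
      have hmem : (fun k => if i = k then (1 : K) else 0) ∈ T := by
        show lin _ ∈ Submodule.restrictScalars K I
        rw [Submodule.restrictScalars_mem]
        convert hi using 1
        exact linearCombination_X_single i
      have := hTf hmem
      rwa [LinearMap.mem_ker] at this
    have hu0 : u = 0 := h u huA hui
    apply hf0
    refine LinearMap.ext fun x => ?_
    rw [hfx, LinearMap.zero_apply]
    exact Finset.sum_eq_zero fun i _ => by rw [hu0, Pi.zero_apply, mul_zero]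
  -- every `x_i ∈ I`
  have hX : ∀ i : Fin 4, (X i : MvPolynomial (Fin 4) K) ∈ I := by
    intro i
    have : (fun k => if i = k then (1 : K) else 0) ∈ T := by rw [hT]; exact Submodule.mem_top
    change lin _ ∈ Submodule.restrictScalars K I at this
    rw [Submodule.restrictScalars_mem] at this
    convert this using 1
    exact (linearCombination_X_single i).symm
  rw [IsolationCert.originIdeal_eq_idealOfVars, MvPolynomial.idealOfVars, Ideal.span_le]
  rintro _ ⟨i, rfl⟩
  exact hX i

/-- In a one-dimensional additive subspace containing a vector `w` with `w_j ≠ 0`, every vector with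
vanishing `j`-th coordinate is `0`. [folklore] -/
theorem eq_zero_of_apply_eq_zero_of_finrank_eq_one {Φ : MvPolynomial (Fin 4) K}
    (hē : Module.finrank K (additiveSubspace Φ) = 1) {w : Fin 4 → K}
    (hw : w ∈ additiveSubspace Φ) {j : Fin 4} (hwj : w j ≠ 0) {u : Fin 4 → K}
    (hu : u ∈ additiveSubspace Φ) (huj : u j = 0) : u = 0 := by
  have hw0 : (⟨w, hw⟩ : additiveSubspace Φ) ≠ 0 := fun h => by
    apply hwj
    have : w = 0 := congrArg Subtype.val h
    rw [this]; rfl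
  obtain ⟨c, hc⟩ := (finrank_eq_one_iff_of_nonzero' _ hw0).mp hē ⟨u, hu⟩
  have hc' : c • w = u := congrArg Subtype.val hc
  have hcj : c * w j = u j := by
    have := congrFun hc' j
    simpa [Pi.smul_apply, smul_eq_mul] using this
  rw [huj] at hcj
  have hc0 : c = 0 := by
    rcases mul_eq_zero.mp hcj with h | h
    · exact h
    · exact absurd h hwj
  rw [← hc', hc0, zero_smul]

/-- **L1a (a narrow floor state is curvilinear along its ridge).**  At a point of order exactly
`q ≥ 2` whose tangent cone has a ONE-dimensional ridge `K·w` (`ē = dim_K A(in F) = 1`), for every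
coordinate `x_j` with `w_j ≠ 0`: `𝔪 ≤ (x_j) ⊔ J_q⁺(F) ⊔ 𝔪²` — every linear form is `c·x_j` plus the
linear part of an element of `J_q⁺(F)`. [OURS · L1 of CARD I-3-10 (crit-1 V-A-26 «apolarity»)]
[cite: BerthomieuHivertMourtada2010, Cor. 2.3] -/
theorem originIdeal_le_span_X_sup {q : ℕ} (hq : 2 ≤ q) {F : MvPolynomial (Fin 4) K}
    (hord : ordZero F = q) (hē : Module.finrank K (additiveSubspace (initialForm F)) = 1)
    {w : Fin 4 → K} (hw : w ∈ additiveSubspace (initialForm F)) {j : Fin 4} (hwj : w j ≠ 0) :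
    originIdeal K ≤
      Ideal.span {(X j : MvPolynomial (Fin 4) K)} ⊔ singLocusIdeal q F ⊔ originIdeal K ^ 2 := by
  refine originIdeal_le_of_forall_additiveSubspace hq hord
    (I := Ideal.span {(X j : MvPolynomial (Fin 4) K)} ⊔ singLocusIdeal q F ⊔ originIdeal K ^ 2)
    (by rw [sup_assoc]; exact le_sup_right) fun u hu hui => ?_
  exact eq_zero_of_apply_eq_zero_of_finrank_eq_one hē hw hwj hu
    (hui j (Ideal.mem_sup_left (Ideal.mem_sup_left (Ideal.subset_span rfl))))

/-- **L1a, the `ē = 0` twin**: if the tangent cone has trivial ridge (`A(in F) = 0`) then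
`𝔪 ≤ J_q⁺(F) ⊔ 𝔪²` — the linear parts of `J_q⁺(F)` are all linear forms (so `μ⁺(F) = 1` at a
certificate). [OURS · L0′ of CARD I-3-10] [cite: BerthomieuHivertMourtada2010, Cor. 2.3] -/
theorem originIdeal_le_sup_of_additiveSubspace_eq_bot {q : ℕ} (hq : 2 ≤ q)
    {F : MvPolynomial (Fin 4) K} (hord : ordZero F = q)
    (h0 : additiveSubspace (initialForm F) = ⊥) :
    originIdeal K ≤ singLocusIdeal q F ⊔ originIdeal K ^ 2 :=
  originIdeal_le_of_forall_additiveSubspace hq hord le_rfl fun u hu _ => by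
    rw [h0] at hu
    exact (Submodule.mem_bot K).mp hu

end NarrowApolarity

end Summit.ResolutionOfSingularities.ResolutionOfSingularities.Theorems.PIDim4

end
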